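import Mathlib
import Literature.AlgebraicGeometry.Resolution.AffineBlowupAlgebra
import Summits.ResolutionOfSingularities.ResolutionOfSingularities.Theorems.FrobeniusLadderFRationalResolutionQuadricConeResolution
import Summits.ResolutionOfSingularities.ResolutionOfSingularities.Theorems.FrobeniusLadderFRationalResolutionChartElimCube
import HarnessLib

/-!
# The elimination chart of the blow-up of the `A_{e+1}` surface `yz + x^(e+2) = 0` at the origin is
the `A_{e-1}` surface `ab + c^e = 0` (crux `FrobeniusLadder.FRationalResolution`, line `Sketch`)

Stub `stub_chart_elim_pow` (worker, T1) of the skeleton `Sketch` for crux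
stmt-ResolutionOfSingularities-15317 (continuation seat c3: rung 4′ is verified on the whole `A_m`
family `{yz + x^(m+1) = 0}` by the tower of point blow-ups; this is the DESCENT STEP on the `x`-chart,
"the `x`-chart of `Bl_0 {yz + x^(e+2) = 0}` is `{ab + c^e = 0}`", as rings).

Let `k` be a field and `R` a `k`-algebra generated by `x, y, z` with `yz + x^(e+2) = 0`, and let
`Rₑ = k[a, b, c]/(ab + c^e)` be the smaller suspension ring, presented (c2 convention) as
`MvPolynomial (Fin 2 ⊕ Fin 1) k ⧸ (X(inl 0) X(inl 1) + X(inr 0)^e)`, with classes `ā, b̄, c̄`. Assume a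
TEST MAP `θ : R → Rₑ[1/c̄]`, `θ x = c̄`, `θ y = ā c̄`, `θ z = b̄ c̄`. Let `B = R[I/x] ⊆ R[1/x]` be the
affine blowup algebra of `I = (x, y, z)` at `x` (image model, `blowupAlgebra`,
`AffineBlowupAlgebra.lean`). Then the `k`-algebra map `φ : Rₑ → R[1/x]`, `ā ↦ u = y/x`,
`b̄ ↦ v = z/x`, `c̄ ↦ w = x`:

* is WELL DEFINED: in `R[1/x]`, `x² · uv = yz = −x^(e+2)` and `x` is a unit, so `uv + x^e = 0`
  (`div_mul_div_add_pow_eq_zero`); `φ` is `MvPolynomial.aeval` at `(u, v, w)` descended to the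
  quotient by `Ideal.Quotient.liftₐ`;
* has RANGE EXACTLY `B`: `u, v ∈ B` (`div_mem_blowupAlgebra`) and `w ∈ B`, so the range lies in `B`;
  conversely `R = k[x, y, z]` (`hgen`) maps into `k[w, u, v]` as `y = u·w`, `z = v·w`, and so does
  every generator `r/x = a + b u + c v` (`r = a x + b y + c z ∈ I`, `div_eq_of_mem_span_triple`) of
  `B` (`coe_blowupAlgebra_eq_adjoin`);
* is INJECTIVE: `θ x = c̄` is a unit of `Rₑ[1/c̄]`, so `θ` extends to `θ' : R[1/x] → Rₑ[1/c̄]`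
  (`IsLocalization.Away.lift`) with `θ'(u) · θ x = θ y`, whence `θ'(u) = ā`, `θ'(v) = b̄`,
  `θ'(w) = c̄`; the composite `Rₑ → R[1/x] → Rₑ[1/c̄]` is the localization map, injective because
  `Rₑ` is a domain (`isPrime_span_suspension`) and `c̄ ≠ 0` (`mk_X_inr_ne_zero`: evaluate at
  `(a, b, c) = (1, −1, 1)`).

References: The Stacks Project, Tag 052Q (affine blowup algebras); U. Görtz, T. Wedhorn,
*Algebraic Geometry I*, 2nd ed. (2020), (13.19) p. 415 (`A[I/f] ⊆ A_f`); J. Kollár, *Lectures on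
Resolution of Singularities* (2007), §2.2 (the `A_n` surface singularities are resolved by `⌈n/2⌉`
point blow-ups; the chart computation is folklore).
-/

-- single-problem summit: the doubled namespace component is forced
set_option linter.dupNamespace false

noncomputable section

namespace Summit.ResolutionOfSingularities.ResolutionOfSingularities.Theorems.FRationalResolution

open Literature.AlgebraicGeometry.Resolution

/-- **The key relation on the `x`-chart**: in `R[1/x]`, if `yz + x^(e+2) = 0` then
`(y/x) · (z/x) + x^e = 0`. [folklore] -/
theorem div_mul_div_add_pow_eq_zero {R : Type*} [CommRing R] {e : ℕ} {x y z : R}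
    (hrel : y * z + x ^ (e + 2) = 0) :
    algebraMap R (Localization.Away x) y * IsLocalization.Away.invSelf x *
        (algebraMap R (Localization.Away x) z * IsLocalization.Away.invSelf x) +
      algebraMap R (Localization.Away x) x ^ e = 0 := by
  have h1 := congrArg (algebraMap R (Localization.Away x)) hrel
  rw [map_add, map_mul, map_pow, map_zero] at h1
  have h2 := IsLocalization.Away.mul_invSelf (S := Localization.Away x) x
  linear_combination (IsLocalization.Away.invSelf x) ^ 2 * h1 -
    (algebraMap R (Localization.Away x) x ^ e *
      (1 + algebraMap R (Localization.Away x) x * IsLocalization.Away.invSelf x)) * h2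

/-- **`c̄ ≠ 0` in `Rₑ = k[a, b, c]/(ab + c^e)`**: the point `(a, b, c) = (1, −1, 1)` lies on
`{ab + c^e = 0}` and has `c ≠ 0`. [folklore] -/
theorem mk_X_inr_ne_zero (k : Type) [Field k] (e : ℕ) :
    Ideal.Quotient.mk (Ideal.span {(MvPolynomial.X (Sum.inl 0) * MvPolynomial.X (Sum.inl 1) +
        MvPolynomial.rename Sum.inr (MvPolynomial.X 0 ^ e) : MvPolynomial (Fin 2 ⊕ Fin 1) k)})
      (MvPolynomial.X (Sum.inr 0)) ≠ 0 := by
  intro h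
  rw [Ideal.Quotient.eq_zero_iff_mem, Ideal.mem_span_singleton'] at h
  obtain ⟨r, hr⟩ := h
  have h1 : MvPolynomial.eval (Sum.elim ![(1 : k), -1] ![1])
      (MvPolynomial.X (Sum.inl 0) * MvPolynomial.X (Sum.inl 1) +
        MvPolynomial.rename Sum.inr (MvPolynomial.X 0 ^ e) : MvPolynomial (Fin 2 ⊕ Fin 1) k) = 0 := by
    simp
  have h2 := congrArg (MvPolynomial.eval (Sum.elim ![(1 : k), -1] ![1])) hr
  rw [map_mul, h1, mul_zero, MvPolynomial.eval_X] at h2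
  simp at h2

/-- **The affine blowup algebra `R[I/x]`, `I = (x, y, z)`, of `R = k[x, y, z]` is `k[x, y/x, z/x]`**
(as subsets of `R[1/x]`): `⊇` since `x, y/x, z/x ∈ R[I/x]`; `⊆` since `R` maps into `k[x, y/x, z/x]`
(`y = (y/x)·x`, `z = (z/x)·x`) and `r/x = a + b (y/x) + c (z/x)` for `r = a x + b y + c z ∈ I`
(Görtz–Wedhorn (13.19), p. 415: `A[I/f]` is generated by the `x/f`). [folklore] -/
theorem coe_blowupAlgebra_eq_adjoin (k : Type*) {R : Type*} [Field k] [CommRing R] [Algebra k R]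
    (x y z : R) (hgen : Algebra.adjoin k {x, y, z} = ⊤) :
    (blowupAlgebra (Ideal.span {x, y, z}) x : Set (Localization.Away x)) =
      Algebra.adjoin k {algebraMap R (Localization.Away x) x,
        algebraMap R (Localization.Away x) y * IsLocalization.Away.invSelf x,
        algebraMap R (Localization.Away x) z * IsLocalization.Away.invSelf x} := by
  set T : Subalgebra k (Localization.Away x) := Algebra.adjoin k {algebraMap R (Localization.Away x) x,
      algebraMap R (Localization.Away x) y * IsLocalization.Away.invSelf x,
      algebraMap R (Localization.Away x) z * IsLocalization.Away.invSelf x} with hT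
  have hwT : algebraMap R (Localization.Away x) x ∈ T := Algebra.subset_adjoin (by simp)
  have huT : algebraMap R (Localization.Away x) y * IsLocalization.Away.invSelf x ∈ T :=
    Algebra.subset_adjoin (by simp)
  have hvT : algebraMap R (Localization.Away x) z * IsLocalization.Away.invSelf x ∈ T :=
    Algebra.subset_adjoin (by simp)
  apply le_antisymm
  · -- `R[I/x] ⊆ k[w, u, v]`: first `R`, then the generators `r/x`
    have hyT : algebraMap R (Localization.Away x) y ∈ T := by
      rw [← div_mul_algebraMap x y]
      exact mul_mem huT hwT
    have hzT : algebraMap R (Localization.Away x) z ∈ T := by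
      rw [← div_mul_algebraMap x z]
      exact mul_mem hvT hwT
    have hR : ∀ r : R, algebraMap R (Localization.Away x) r ∈ T := by
      intro r
      have hr : r ∈ Algebra.adjoin k ({x, y, z} : Set R) := by rw [hgen]; exact Algebra.mem_top
      induction hr using Algebra.adjoin_induction with
      | mem r hr =>
        simp only [Set.mem_insert_iff, Set.mem_singleton_iff] at hr
        rcases hr with rfl | rfl | rfl
        · exact hwT
        · exact hyT
        · exact hzT
      | algebraMap c =>
        rw [← IsScalarTower.algebraMap_apply]
        exact Subalgebra.algebraMap_mem T c
      | add r s _ _ hr hs => rw [map_add]; exact add_mem hr hs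
      | mul r s _ _ hr hs => rw [map_mul]; exact mul_mem hr hs
    intro l hl
    change l ∈ T
    induction hl using Algebra.adjoin_induction with
    | mem l hl =>
      obtain ⟨r, hr, rfl⟩ := hl
      obtain ⟨a, b, c, h⟩ := div_eq_of_mem_span_triple hr
      rw [h]
      exact add_mem (add_mem (hR a) (mul_mem (hR b) huT)) (mul_mem (hR c) hvT)
    | algebraMap r => exact hR r
    | add _ _ _ _ h h' => exact add_mem h h'
    | mul _ _ _ _ h h' => exact mul_mem h h'
  · -- `k[w, u, v] ⊆ R[I/x]`
    have hyI : y ∈ Ideal.span ({x, y, z} : Set R) := Ideal.subset_span (by simp)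
    have hzI : z ∈ Ideal.span ({x, y, z} : Set R) := Ideal.subset_span (by simp)
    have hle : T ≤ (blowupAlgebra (Ideal.span ({x, y, z} : Set R)) x).restrictScalars k := by
      refine Algebra.adjoin_le ?_
      refine Set.insert_subset_iff.mpr ⟨Subalgebra.algebraMap_mem _ x, Set.insert_subset_iff.mpr
        ⟨div_mem_blowupAlgebra _ x hyI, Set.singleton_subset_iff.mpr (div_mem_blowupAlgebra _ x hzI)⟩⟩
    intro l hl
    exact hle hl

/-- **The elimination chart from a presentation** (the content of `stub_chart_elim_pow`, for an
abstract generator `g = ab + c^e` of the defining ideal of `Rₑ = k[a, b, c]/(g)`, assumed prime with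
`c̄ ≠ 0`): the `k`-algebra map `Rₑ → R[1/x]`, `ā ↦ y/x`, `b̄ ↦ z/x`, `c̄ ↦ x`, is well defined,
injective (through the extension of the test map `θ` to `R[1/x]` the composite is the localization
map `Rₑ → Rₑ[1/c̄]`) and has range the affine blowup algebra `R[I/x]`, `I = (x, y, z)`.
[folklore] -/
theorem chart_elim_of_presentation (k R : Type) [Field k] [CommRing R] [Algebra k R] (e : ℕ)
    (x y z : R) (hrel : y * z + x ^ (e + 2) = 0) (hgen : Algebra.adjoin k {x, y, z} = ⊤)
    (g : MvPolynomial (Fin 2 ⊕ Fin 1) k)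
    (hg : g = MvPolynomial.X (Sum.inl 0) * MvPolynomial.X (Sum.inl 1) + MvPolynomial.X (Sum.inr 0) ^ e)
    (hprime : (Ideal.span {g}).IsPrime)
    (hc0 : Ideal.Quotient.mk (Ideal.span {g}) (MvPolynomial.X (Sum.inr 0)) ≠ 0)
    (θ : R →ₐ[k] Localization.Away (Ideal.Quotient.mk (Ideal.span {g}) (MvPolynomial.X (Sum.inr 0))))
    (hθx : θ x = algebraMap _ _ (Ideal.Quotient.mk (Ideal.span {g}) (MvPolynomial.X (Sum.inr 0))))
    (hθy : θ y = algebraMap _ _ (Ideal.Quotient.mk (Ideal.span {g})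
      (MvPolynomial.X (Sum.inl 0) * MvPolynomial.X (Sum.inr 0))))
    (hθz : θ z = algebraMap _ _ (Ideal.Quotient.mk (Ideal.span {g})
      (MvPolynomial.X (Sum.inl 1) * MvPolynomial.X (Sum.inr 0)))) :
    ∃ φ : (MvPolynomial (Fin 2 ⊕ Fin 1) k ⧸ Ideal.span {g}) →ₐ[k] Localization.Away x,
      Function.Injective φ ∧
      Set.range φ = (blowupAlgebra (Ideal.span {x, y, z}) x : Set (Localization.Away x)) ∧
      φ (Ideal.Quotient.mk _ (MvPolynomial.X (Sum.inr 0))) = algebraMap R _ x ∧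
      φ (Ideal.Quotient.mk _ (MvPolynomial.X (Sum.inl 0))) * algebraMap R _ x = algebraMap R _ y ∧
      φ (Ideal.Quotient.mk _ (MvPolynomial.X (Sum.inl 1))) * algebraMap R _ x = algebraMap R _ z := by
  haveI := hprime
  haveI : IsDomain (MvPolynomial (Fin 2 ⊕ Fin 1) k ⧸ Ideal.span {g}) := Ideal.Quotient.isDomain _
  -- (1) the fractions `u = y/x`, `v = z/x` and `w = x` in `L = R[1/x]` satisfy `uv + w^e = 0`
  have huv := div_mul_div_add_pow_eq_zero hrel
  -- (2) the evaluation `φ₀ : k[a, b, c] → R[1/x]` at `(u, v, w)` and its descent `φ` to `Rₑ`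
  let φ₀ : MvPolynomial (Fin 2 ⊕ Fin 1) k →ₐ[k] Localization.Away x :=
    MvPolynomial.aeval (Sum.elim
      ![algebraMap R (Localization.Away x) y * IsLocalization.Away.invSelf x,
        algebraMap R (Localization.Away x) z * IsLocalization.Away.invSelf x]
      ![algebraMap R (Localization.Away x) x])
  have hφ₀a : φ₀ (MvPolynomial.X (Sum.inl 0)) =
      algebraMap R (Localization.Away x) y * IsLocalization.Away.invSelf x := by
    simp [φ₀]
  have hφ₀b : φ₀ (MvPolynomial.X (Sum.inl 1)) =
      algebraMap R (Localization.Away x) z * IsLocalization.Away.invSelf x := by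
    simp [φ₀]
  have hφ₀c : φ₀ (MvPolynomial.X (Sum.inr 0)) = algebraMap R (Localization.Away x) x := by
    simp [φ₀]
  have hφ₀C : ∀ c, φ₀ (MvPolynomial.C c) = algebraMap R (Localization.Away x) (algebraMap k R c) := by
    intro c
    rw [MvPolynomial.algHom_C, IsScalarTower.algebraMap_apply k R (Localization.Away x)]
  have hφ₀g : φ₀ g = 0 := by
    rw [hg, map_add, map_mul, map_pow, hφ₀a, hφ₀b, hφ₀c]
    exact huv
  have hker : ∀ s ∈ Ideal.span {g}, φ₀ s = 0 := by
    intro s hs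
    obtain ⟨r, rfl⟩ := Ideal.mem_span_singleton'.mp hs
    rw [map_mul, hφ₀g, mul_zero]
  let φ : (MvPolynomial (Fin 2 ⊕ Fin 1) k ⧸ Ideal.span {g}) →ₐ[k] Localization.Away x :=
    Ideal.Quotient.liftₐ (Ideal.span {g}) φ₀ hker
  have hφmk : ∀ s, φ (Ideal.Quotient.mk (Ideal.span {g}) s) = φ₀ s := fun s =>
    AlgHom.congr_fun (Ideal.Quotient.liftₐ_comp (Ideal.span {g}) φ₀ hker) s
  have hφa : φ (Ideal.Quotient.mk (Ideal.span {g}) (MvPolynomial.X (Sum.inl 0))) =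
      algebraMap R (Localization.Away x) y * IsLocalization.Away.invSelf x := by rw [hφmk, hφ₀a]
  have hφb : φ (Ideal.Quotient.mk (Ideal.span {g}) (MvPolynomial.X (Sum.inl 1))) =
      algebraMap R (Localization.Away x) z * IsLocalization.Away.invSelf x := by rw [hφmk, hφ₀b]
  have hφc : φ (Ideal.Quotient.mk (Ideal.span {g}) (MvPolynomial.X (Sum.inr 0))) =
      algebraMap R (Localization.Away x) x := by rw [hφmk, hφ₀c]
  -- (3) RANGE `= R[I/x] = k[w, u, v]`
  have hyI : y ∈ Ideal.span ({x, y, z} : Set R) := Ideal.subset_span (by simp)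
  have hzI : z ∈ Ideal.span ({x, y, z} : Set R) := Ideal.subset_span (by simp)
  have hφ₀X : ∀ i, φ₀ (MvPolynomial.X i) ∈ blowupAlgebra (Ideal.span ({x, y, z} : Set R)) x := by
    refine Sum.forall.mpr ⟨Fin.forall_fin_two.mpr ⟨?_, ?_⟩, Fin.forall_fin_one.mpr ?_⟩
    · rw [hφ₀a]; exact div_mem_blowupAlgebra _ x hyI
    · rw [hφ₀b]; exact div_mem_blowupAlgebra _ x hzI
    · rw [hφ₀c]; exact Subalgebra.algebraMap_mem _ x
  have hφ₀B : ∀ s, φ₀ s ∈ blowupAlgebra (Ideal.span ({x, y, z} : Set R)) x := by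
    intro s
    induction s using MvPolynomial.induction_on with
    | C c => rw [hφ₀C]; exact Subalgebra.algebraMap_mem _ _
    | add p q hp hq => rw [map_add]; exact Subalgebra.add_mem _ hp hq
    | mul_X p i hp => rw [map_mul]; exact Subalgebra.mul_mem _ hp (hφ₀X i)
  have hrange : Set.range φ = (blowupAlgebra (Ideal.span {x, y, z}) x : Set (Localization.Away x)) := by
    apply le_antisymm
    · rintro _ ⟨q, rfl⟩
      obtain ⟨s, rfl⟩ := Ideal.Quotient.mk_surjective q
      rw [hφmk]
      exact hφ₀B s
    · rw [coe_blowupAlgebra_eq_adjoin k x y z hgen, ← AlgHom.coe_range]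
      change Algebra.adjoin k _ ≤ φ.range
      refine Algebra.adjoin_le ?_
      refine Set.insert_subset_iff.mpr ⟨⟨_, hφc⟩, Set.insert_subset_iff.mpr
        ⟨⟨_, hφa⟩, Set.singleton_subset_iff.mpr ⟨_, hφb⟩⟩⟩
  -- (4) INJECTIVE: extend `θ` to `θ' : R[1/x] → Rₑ[1/c̄]`; then `θ' ∘ φ` is the localization map
  have hunit : IsUnit (θ.toRingHom x) := by
    rw [AlgHom.toRingHom_eq_coe, RingHom.coe_coe, hθx]
    exact IsLocalization.Away.algebraMap_isUnit _
  have hunit' : IsUnit (θ x) := hunit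
  have hlift : ∀ r, IsLocalization.Away.lift x hunit (algebraMap R (Localization.Away x) r) = θ r :=
    fun r => IsLocalization.Away.lift_eq x hunit r
  have hθ'u : IsLocalization.Away.lift x hunit (algebraMap R (Localization.Away x) y *
      IsLocalization.Away.invSelf x) =
      algebraMap _ (Localization.Away (Ideal.Quotient.mk (Ideal.span {g}) (MvPolynomial.X (Sum.inr 0))))
        (Ideal.Quotient.mk (Ideal.span {g}) (MvPolynomial.X (Sum.inl 0))) := by
    rw [← hunit'.mul_left_inj, ← hlift x, ← map_mul, div_mul_algebraMap, hlift, hlift, hθy, hθx,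
      map_mul, map_mul]
  have hθ'v : IsLocalization.Away.lift x hunit (algebraMap R (Localization.Away x) z *
      IsLocalization.Away.invSelf x) =
      algebraMap _ (Localization.Away (Ideal.Quotient.mk (Ideal.span {g}) (MvPolynomial.X (Sum.inr 0))))
        (Ideal.Quotient.mk (Ideal.span {g}) (MvPolynomial.X (Sum.inl 1))) := by
    rw [← hunit'.mul_left_inj, ← hlift x, ← map_mul, div_mul_algebraMap, hlift, hlift, hθz, hθx,
      map_mul, map_mul]
  have hcomp : (IsLocalization.Away.lift x hunit).comp φ.toRingHom =
      algebraMap (MvPolynomial (Fin 2 ⊕ Fin 1) k ⧸ Ideal.span {g})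
        (Localization.Away (Ideal.Quotient.mk (Ideal.span {g}) (MvPolynomial.X (Sum.inr 0)))) := by
    refine Ideal.Quotient.ringHom_ext (MvPolynomial.ringHom_ext (fun c => ?_)
      (Sum.forall.mpr ⟨Fin.forall_fin_two.mpr ⟨?_, ?_⟩, Fin.forall_fin_one.mpr ?_⟩))
    · change IsLocalization.Away.lift x hunit (φ (Ideal.Quotient.mk (Ideal.span {g})
        (MvPolynomial.C c))) = algebraMap _ _ (Ideal.Quotient.mk (Ideal.span {g}) (MvPolynomial.C c))
      rw [hφmk, hφ₀C, hlift, AlgHom.commutes, ← MvPolynomial.algebraMap_eq,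
        Ideal.Quotient.mk_algebraMap, ← IsScalarTower.algebraMap_apply]
    · change IsLocalization.Away.lift x hunit (φ (Ideal.Quotient.mk (Ideal.span {g})
        (MvPolynomial.X (Sum.inl 0)))) =
          algebraMap _ _ (Ideal.Quotient.mk (Ideal.span {g}) (MvPolynomial.X (Sum.inl 0)))
      rw [hφa, hθ'u]
    · change IsLocalization.Away.lift x hunit (φ (Ideal.Quotient.mk (Ideal.span {g})
        (MvPolynomial.X (Sum.inl 1)))) =
          algebraMap _ _ (Ideal.Quotient.mk (Ideal.span {g}) (MvPolynomial.X (Sum.inl 1)))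
      rw [hφb, hθ'v]
    · change IsLocalization.Away.lift x hunit (φ (Ideal.Quotient.mk (Ideal.span {g})
        (MvPolynomial.X (Sum.inr 0)))) =
          algebraMap _ _ (Ideal.Quotient.mk (Ideal.span {g}) (MvPolynomial.X (Sum.inr 0)))
      rw [hφc, hlift, hθx]
  have hinj' : Function.Injective ((IsLocalization.Away.lift x hunit).comp φ.toRingHom) := by
    rw [hcomp]
    exact IsLocalization.injective (M := Submonoid.powers
      (Ideal.Quotient.mk (Ideal.span {g}) (MvPolynomial.X (Sum.inr 0)))) (Localization.Away
      (Ideal.Quotient.mk (Ideal.span {g}) (MvPolynomial.X (Sum.inr 0))))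
      (powers_le_nonZeroDivisors_of_noZeroDivisors hc0)
  have hinj : Function.Injective φ := by
    intro p q hpq
    apply hinj'
    change IsLocalization.Away.lift x hunit (φ p) = IsLocalization.Away.lift x hunit (φ q)
    rw [hpq]
  -- (5) assemble
  refine ⟨φ, hinj, hrange, hφc, ?_, ?_⟩
  · rw [hφa, div_mul_algebraMap]
  · rw [hφb, div_mul_algebraMap]

/-- **Registered stub `stub_chart_elim_pow` — ELIMINATION CHART OF THE BLOW-UP OF `A_m` AT THE
ORIGIN IS `A_{m−2}`.** For a `k`-algebra `R` generated by `x, y, z` with `yz + x^(e+2) = 0` and a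
test map `θ : R → Rₑ[1/c̄]` into the localization of the smaller suspension ring
`Rₑ = k[a, b, c]/(ab + c^e)` with `θ x = c̄`, `θ y = ā c̄`, `θ z = b̄ c̄`, the `k`-algebra map
`Rₑ → R[1/x]`, `ā ↦ y/x`, `b̄ ↦ z/x`, `c̄ ↦ x`, is well defined (`(y/x)(z/x) = −x^e`), INJECTIVE
(followed by the extension of `θ` to `R[1/x]` it is the localization map `Rₑ → Rₑ[1/c̄]` of the
domain `Rₑ`, `isPrime_span_suspension`, at `c̄ ≠ 0`, `mk_X_inr_ne_zero`) and has range EXACTLY the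
affine blowup algebra `R[I/x]`, `I = (x, y, z)` (`coe_blowupAlgebra_eq_adjoin`). So the `x`-chart of
`Bl_0 {yz + x^(e+2) = 0}` is `{ab + c^e = 0}`: the `A_m` tower descends by two
(`chart_elim_of_presentation`). [Kollár 2007 §2.2; folklore] -/
theorem stub_chart_elim_pow (k R : Type) [Field k] [CommRing R] [Algebra k R] (e : ℕ)
    (x y z : R) (hrel : y * z + x ^ (e + 2) = 0) (hgen : Algebra.adjoin k {x, y, z} = ⊤)
    (θ : R →ₐ[k] Localization.Away (Ideal.Quotient.mk (Ideal.span
      {(MvPolynomial.X (Sum.inl 0) * MvPolynomial.X (Sum.inl 1) +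
        MvPolynomial.rename Sum.inr (MvPolynomial.X 0 ^ e) : MvPolynomial (Fin 2 ⊕ Fin 1) k)})
      (MvPolynomial.X (Sum.inr 0))))
    (hθx : θ x = algebraMap _ _ (Ideal.Quotient.mk (Ideal.span
      {(MvPolynomial.X (Sum.inl 0) * MvPolynomial.X (Sum.inl 1) +
        MvPolynomial.rename Sum.inr (MvPolynomial.X 0 ^ e) : MvPolynomial (Fin 2 ⊕ Fin 1) k)})
      (MvPolynomial.X (Sum.inr 0))))
    (hθy : θ y = algebraMap _ _ (Ideal.Quotient.mk (Ideal.span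
      {(MvPolynomial.X (Sum.inl 0) * MvPolynomial.X (Sum.inl 1) +
        MvPolynomial.rename Sum.inr (MvPolynomial.X 0 ^ e) : MvPolynomial (Fin 2 ⊕ Fin 1) k)})
      (MvPolynomial.X (Sum.inl 0) * MvPolynomial.X (Sum.inr 0))))
    (hθz : θ z = algebraMap _ _ (Ideal.Quotient.mk (Ideal.span
      {(MvPolynomial.X (Sum.inl 0) * MvPolynomial.X (Sum.inl 1) +
        MvPolynomial.rename Sum.inr (MvPolynomial.X 0 ^ e) : MvPolynomial (Fin 2 ⊕ Fin 1) k)})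
      (MvPolynomial.X (Sum.inl 1) * MvPolynomial.X (Sum.inr 0)))) :
    ∃ φ : (MvPolynomial (Fin 2 ⊕ Fin 1) k ⧸ Ideal.span
        {(MvPolynomial.X (Sum.inl 0) * MvPolynomial.X (Sum.inl 1) +
          MvPolynomial.rename Sum.inr (MvPolynomial.X 0 ^ e) : MvPolynomial (Fin 2 ⊕ Fin 1) k)}) →ₐ[k]
        Localization.Away x,
      Function.Injective φ ∧
      Set.range φ = (blowupAlgebra (Ideal.span {x, y, z}) x : Set (Localization.Away x)) ∧
      φ (Ideal.Quotient.mk _ (MvPolynomial.X (Sum.inr 0))) = algebraMap R _ x ∧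
      φ (Ideal.Quotient.mk _ (MvPolynomial.X (Sum.inl 0))) * algebraMap R _ x = algebraMap R _ y ∧
      φ (Ideal.Quotient.mk _ (MvPolynomial.X (Sum.inl 1))) * algebraMap R _ x = algebraMap R _ z :=
  chart_elim_of_presentation k R e x y z hrel hgen
    (MvPolynomial.X (Sum.inl 0) * MvPolynomial.X (Sum.inl 1) +
      MvPolynomial.rename Sum.inr (MvPolynomial.X 0 ^ e))
    (by rw [map_pow, MvPolynomial.rename_X])
    (isPrime_span_suspension k 1 (MvPolynomial.X 0 ^ e) (pow_ne_zero _ (MvPolynomial.X_ne_zero 0)))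
    (mk_X_inr_ne_zero k e) θ hθx hθy hθz

end Summit.ResolutionOfSingularities.ResolutionOfSingularities.Theorems.FRationalResolution

end
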